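import Literature.Probability.Process.BrownianVecOccupationKernel
import Literature.Probability.Process.BrownianVecHarmonic
import HarnessLib

/-!
# Bounded harmonic functions on `ℝᵈ` are constant (Liouville), by Brownian motion
# (Durrett 2019, §9.5, Exercise 9.5.1)

Topic `Probability/Process`. R. Durrett, *Probability: Theory and Examples* (5th ed., 2019), §9.5,
Exercise 9.5.1 (p. 363 = PDF p0375 of the held copy), VERBATIM: "9.5.1 Suppose `h` is bounded and
harmonic on `R^d`. Prove that `h` is constant." — for the `d`-dimensional Brownian motion `W` of
the tree's hypothesis structure `IsBrownianVec W P` (`BrownianVec.lean`), with the tree's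
Laplacian `lap` (`GaussianTaylorStep.lean`), the stopped-martingale identity for harmonic
functions (`integral_stoppedProcess_eq_of_harmonic`, `BrownianVecHarmonic.lean`) and the
transition density `E f(x + W_t) = ∫ p_t(x, y) f(y) dy` (`integral_comp_shift_eq`,
`BrownianVecOccupationKernel.lean`). THEOREMS ONLY (no definition, no named fact, no instance,
no notation, no axiom).

## The proof typed here

(1) **Invariance under the heat semigroup**: for `h ∈ C²(ℝᵈ)` bounded with `Δh = 0`,
`E h(x + W_t) = h(x)` for every `t` (`integral_comp_add_eq_of_harmonic`): optional stopping at
the exit times `T_n` of the balls `B(x, n+1)` (the tree's `integral_stoppedProcess_eq_of_harmonic`)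
and bounded convergence, `T_n > t` eventually along every path.
(2) **The density ratio**: with `p_t(x, y) = (2πt)^{−d/2} e^{−|x−y|²/2t}` and
`R(y) = p_t(x', y)/p_t(x, y) = exp((|x−y|² − |x'−y|²)/2t)`, `h(x') = E[R(X) h(X)]` for `X = x + W_t`,
`E R(X) = 1` and `E R(X)² = e^{|x−x'|²/t}` (`p_t(x', y)²/p_t(x, y) = e^{|x−x'|²/t} p_t(2x'−x, y)`), so
`|h(x) − h(x')| = |E[h(X)(1 − R(X))]| ≤ ‖h‖_∞ (E(1 − R(X))²)^{1/2} = ‖h‖_∞ (e^{|x−x'|²/t} − 1)^{1/2}`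
(`abs_sub_le_mul_sqrt_exp_sub_one`), which tends to `0` as `t → ∞`.
(This replaces the coupling / tail-σ-field arguments one might expect by an explicit
`L²`-distance between the Gaussian transition kernels; the statement proved is exactly the
exercise.)

| Durrett 2019, §9.5 | here | status |
|---|---|---|
| `E h(x + W_t) = h(x)` for bounded harmonic `h ∈ C²(ℝᵈ)` | `IsBrownianVec.integral_comp_add_eq_of_harmonic` | proved |
| `|h(x) − h(x')| ≤ ‖h‖_∞ √(e^{|x−x'|²/t} − 1)` | `IsBrownianVec.abs_sub_le_mul_sqrt_exp_sub_one` | proved |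
| **Exercise 9.5.1** bounded harmonic functions on `ℝᵈ` are constant | `IsBrownianVec.Durrett2019_exercise_9_5_1` | proved |

## References

* [Durrett2019] R. Durrett, *Probability: Theory and Examples*, 5th ed., Cambridge University
  Press (2019), doi:10.1017/9781108591034, §9.5 Exercise 9.5.1 (p. 363, PDF p0375); §9.2 proof
  of Theorem 9.2.5 and §9.6 (the transition density `p_t`).
-/

noncomputable section

open MeasureTheory ProbabilityTheory Filter Topology Set Metric
open scoped NNReal ENNReal BigOperators

namespace Literature.Probability.Process

namespace IsBrownianVec

variable {d : ℕ} {Ω : Type*} {mΩ : MeasurableSpace Ω} {P : Measure Ω} {W : ℝ≥0 → Ω → (Fin d → ℝ)}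

/-! ### §1 Bounded harmonic functions are invariant under the heat semigroup -/

/-- **`E h(x + W_t) = h(x)` for a bounded harmonic function.** Let `h : ℝᵈ → ℝ` be `C²` and
bounded with `Δh = 0` everywhere. Then `E h(x + W_t) = h(x)` for every `x` and `t ≥ 0`: by the
tree's optional-stopping identity `E h(x + W_{t ∧ T_n}) = h(x)` at the exit times `T_n` of the
balls `{|y − x|² < (n+1)²}` and bounded convergence (`T_n > t` for large `n`, every path being
bounded on `[0, t]`). [cite: Durrett2019, §9.5 Exercise 9.5.1] -/
theorem integral_comp_add_eq_of_harmonic [IsProbabilityMeasure P] (hW : IsBrownianVec W P)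
    {h : (Fin d → ℝ) → ℝ} (hh : ContDiff ℝ 2 h) (hΔ : ∀ y, lap h y = 0) {C : ℝ}
    (hC : ∀ y, |h y| ≤ C) (x : Fin d → ℝ) (t : ℝ≥0) :
    ∫ ω, h (x + W t ω) ∂P = h x := by
  -- the exhausting balls and their exit times
  set F : ℕ → Set (Fin d → ℝ) := fun n ↦
    {y : Fin d → ℝ | ((n : ℝ) + 1) ^ 2 ≤ ∑ j, (y j - x j) ^ 2} with hFdef
  have hsq : Continuous fun y : Fin d → ℝ ↦ ∑ j, (y j - x j) ^ 2 :=
    continuous_finsetSum _ fun j _ ↦ ((continuous_apply j).sub continuous_const).pow 2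
  have hFc : ∀ n, IsClosed (F n) := fun n ↦ isClosed_le continuous_const hsq
  have hFb : ∀ n, Bornology.IsBounded (F n)ᶜ := fun n ↦ by
    refine (Metric.isBounded_closedBall (x := x) (r := (n : ℝ) + 1)).subset fun y hy ↦ ?_
    simp only [hFdef, mem_compl_iff, mem_setOf_eq, not_le] at hy
    rw [Metric.mem_closedBall, dist_pi_le_iff (by positivity)]
    intro j
    rw [Real.dist_eq]
    have hj : (y j - x j) ^ 2 ≤ ∑ i, (y i - x i) ^ 2 :=
      Finset.single_le_sum (fun i _ ↦ sq_nonneg (y i - x i)) (Finset.mem_univ j)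
    exact abs_le_of_sq_le_sq (hj.trans hy.le) (by positivity)
  have hxF : ∀ n, x ∉ F n := fun n h0 ↦ by
    simp only [hFdef, mem_setOf_eq, sub_self] at h0
    simp at h0
    linarith [h0, sq_nonneg ((n : ℝ) + 1), show (0 : ℝ) < ((n : ℝ) + 1) ^ 2 by positivity]
  -- optional stopping: `E h(x + W_{t ∧ T_n}) = h(x)`
  have hstep : ∀ n : ℕ, Integrable (stoppedProcess (fun r ω ↦ h (x + W r ω)) (hitTime x W (F n)) t)
      P ∧ ∫ ω, stoppedProcess (fun r ω ↦ h (x + W r ω)) (hitTime x W (F n)) t ω ∂P = h x :=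
    fun n ↦ hW.integral_stoppedProcess_eq_of_harmonic isOpen_univ hh.contDiffOn
      (fun y _ ↦ hΔ y) (hFc n) (hFb n) (subset_univ _) (hxF n) t
  -- along every path, `T_n > t` for large `n`, so the stopped value is eventually `h(x + W_t)`
  have hlim : ∀ ω, Tendsto (fun n : ℕ ↦ stoppedProcess (fun r ω ↦ h (x + W r ω))
      (hitTime x W (F n)) t ω) atTop (𝓝 (h (x + W t ω))) := by
    intro ω
    -- the path `r ↦ |W_r|²` is bounded on `[0, t]`
    have hcont : Continuous fun r : ℝ≥0 ↦ ∑ j, (W r ω) j ^ 2 :=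
      (continuous_finsetSum _ fun j _ ↦ (continuous_apply j).pow 2).comp (hW.continuous_path ω)
    obtain ⟨M, hM⟩ := (isCompact_Icc (a := (0 : ℝ≥0)) (b := t)).exists_bound_of_continuousOn
      hcont.continuousOn
    obtain ⟨N, hN⟩ := exists_nat_gt M
    refine tendsto_atTop_of_eventually_const (i₀ := N) fun n hn ↦ ?_
    have hgt : (t : WithTop ℝ≥0) < hitTime x W (F n) ω := by
      by_contra hle
      rw [not_lt, hW.hitTime_le_coe_iff (hFc n)] at hle
      obtain ⟨j, hj, hjF⟩ := hle
      simp only [hFdef, mem_setOf_eq, Pi.add_apply, add_sub_cancel_left] at hjF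
      have h1 := hM j ⟨bot_le, hj⟩
      rw [Real.norm_eq_abs, abs_of_nonneg (Finset.sum_nonneg fun i _ ↦ sq_nonneg _)] at h1
      have h2 : (N : ℝ) ≤ n := by exact_mod_cast hn
      nlinarith
    exact stoppedProcess_eq_of_le hgt.le
  -- bounded convergence
  have hbound : ∀ n, ∀ᵐ ω ∂P, ‖stoppedProcess (fun r ω ↦ h (x + W r ω)) (hitTime x W (F n)) t ω‖
      ≤ C := fun n ↦ ae_of_all _ fun ω ↦ by
    simp only [stoppedProcess, Real.norm_eq_abs]
    exact hC _
  have hconv := tendsto_integral_of_dominated_convergence (fun _ ↦ C)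
    (fun n ↦ (hstep n).1.aestronglyMeasurable) (integrable_const C) hbound
    (ae_of_all _ hlim)
  have hconst : Tendsto (fun n : ℕ ↦ ∫ ω, stoppedProcess (fun r ω ↦ h (x + W r ω))
      (hitTime x W (F n)) t ω ∂P) atTop (𝓝 (h x)) := by
    simp_rw [fun n ↦ (hstep n).2]
    exact tendsto_const_nhds
  exact tendsto_nhds_unique hconv hconst

/-! ### §2 The `L²` distance between the transition kernels from `x` and `x'` -/

/-- The density ratio times the kernel: `p_t(x, y) R(y) = p_t(x', y)` for
`R(y) = exp((|x − y|² − |x' − y|²)/2t)`. [folklore] -/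
private theorem kernel_mul_ratio (t : ℝ) (x x' y : Fin d → ℝ) :
    (2 * Real.pi * t) ^ (-(d : ℝ) / 2) * Real.exp (-(∑ j, (x j - y j) ^ 2) / (2 * t)) *
        Real.exp (((∑ j, (x j - y j) ^ 2) - ∑ j, (x' j - y j) ^ 2) / (2 * t)) =
      (2 * Real.pi * t) ^ (-(d : ℝ) / 2) * Real.exp (-(∑ j, (x' j - y j) ^ 2) / (2 * t)) := by
  rw [mul_assoc, ← Real.exp_add]
  congr 2
  ring

/-- The squared density ratio times the kernel:
`p_t(x, y) R(y)² = e^{|x − x'|²/t} p_t(2x' − x, y)`. [folklore] -/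
private theorem kernel_mul_ratio_sq {t : ℝ} (ht : t ≠ 0) (x x' y : Fin d → ℝ) :
    (2 * Real.pi * t) ^ (-(d : ℝ) / 2) * Real.exp (-(∑ j, (x j - y j) ^ 2) / (2 * t)) *
        Real.exp (((∑ j, (x j - y j) ^ 2) - ∑ j, (x' j - y j) ^ 2) / (2 * t)) ^ 2 =
      Real.exp ((∑ j, (x j - x' j) ^ 2) / t) * ((2 * Real.pi * t) ^ (-(d : ℝ) / 2) *
        Real.exp (-(∑ j, ((fun i ↦ 2 * x' i - x i) j - y j) ^ 2) / (2 * t))) := by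
  rw [← Real.exp_nat_mul, mul_assoc, ← Real.exp_add, mul_left_comm, ← Real.exp_add]
  congr 2
  have hcoord : ∀ j, (x j - y j) ^ 2 - 2 * (x' j - y j) ^ 2 =
      2 * (x j - x' j) ^ 2 - (2 * x' j - x j - y j) ^ 2 := fun j ↦ by ring
  have hsum : (∑ j, (x j - y j) ^ 2) - 2 * ∑ j, (x' j - y j) ^ 2 =
      2 * (∑ j, (x j - x' j) ^ 2) - ∑ j, (2 * x' j - x j - y j) ^ 2 := by
    rw [Finset.mul_sum, Finset.mul_sum, ← Finset.sum_sub_distrib, ← Finset.sum_sub_distrib]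
    exact Finset.sum_congr rfl fun j _ ↦ hcoord j
  field_simp
  push_cast
  linarith [hsum]

/-- `(∫ |Y|)² ≤ ∫ Y²` on a probability space (Cauchy–Schwarz / Jensen), for `Y²` integrable and
`Y` measurable. [folklore] -/
private theorem sq_integral_abs_le_integral_sq [IsProbabilityMeasure P] {Y : Ω → ℝ}
    (hYm : AEStronglyMeasurable Y P) (hY2 : Integrable (fun ω ↦ Y ω ^ 2) P) :
    (∫ ω, |Y ω| ∂P) ^ 2 ≤ ∫ ω, Y ω ^ 2 ∂P := by
  have hY1 : Integrable (fun ω ↦ |Y ω|) P := by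
    have h2 : MemLp Y 2 P := (memLp_two_iff_integrable_sq hYm).2 hY2
    exact (h2.integrable one_le_two).abs
  set m : ℝ := ∫ ω, |Y ω| ∂P with hm
  have hexp : ∫ ω, (|Y ω| - m) ^ 2 ∂P = (∫ ω, Y ω ^ 2 ∂P) - m ^ 2 := by
    have hfun : (fun ω ↦ (|Y ω| - m) ^ 2) = fun ω ↦ Y ω ^ 2 - 2 * m * |Y ω| + m ^ 2 := by
      funext ω
      rw [sub_sq, sq_abs]
      ring
    rw [hfun, integral_add (f := fun ω ↦ Y ω ^ 2 - 2 * m * |Y ω|) (g := fun _ ↦ m ^ 2)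
      (hY2.sub (hY1.const_mul _)) (integrable_const _),
      integral_sub hY2 (hY1.const_mul _), integral_const_mul, integral_const, probReal_univ,
      one_smul, ← hm]
    ring
  have hnn : 0 ≤ ∫ ω, (|Y ω| - m) ^ 2 ∂P := integral_nonneg fun ω ↦ sq_nonneg _
  linarith

/-- **The `L²` bound for the difference of values of a bounded harmonic function** (the heart of
the probabilistic proof of Liouville's theorem): for `h ∈ C²(ℝᵈ)` bounded by `C` with `Δh = 0`,
all `x, x'` and every `t > 0`,
`|h(x) − h(x')| ≤ C √(e^{|x−x'|²/t} − 1)`: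
`h(x) − h(x') = E[h(X)(1 − R(X))]` for `X = x + W_t` and the density ratio
`R = p_t(x', ·)/p_t(x, ·)`, with `E R(X) = 1`, `E R(X)² = e^{|x−x'|²/t}`.
[cite: Durrett2019, §9.5 Exercise 9.5.1] -/
theorem abs_sub_le_mul_sqrt_exp_sub_one [IsProbabilityMeasure P] (hW : IsBrownianVec W P)
    {h : (Fin d → ℝ) → ℝ} (hh : ContDiff ℝ 2 h) (hΔ : ∀ y, lap h y = 0) {C : ℝ}
    (hC : ∀ y, |h y| ≤ C) (x x' : Fin d → ℝ) {t : ℝ≥0} (ht : t ≠ 0) :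
    |h x - h x'| ≤ C * Real.sqrt (Real.exp ((∑ j, (x j - x' j) ^ 2) / t) - 1) := by
  have ht' : (t : ℝ) ≠ 0 := by exact_mod_cast ht
  have hC0 : 0 ≤ C := (abs_nonneg _).trans (hC x)
  have hhm : Measurable h := hh.continuous.measurable
  -- the kernel `K z y = p_t(z, y)` and the density ratio `R`
  set K : (Fin d → ℝ) → (Fin d → ℝ) → ℝ := fun z y ↦
    (2 * Real.pi * t) ^ (-(d : ℝ) / 2) * Real.exp (-(∑ j, (z j - y j) ^ 2) / (2 * t)) with hKdef
  set R : (Fin d → ℝ) → ℝ := fun y ↦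
    Real.exp (((∑ j, (x j - y j) ^ 2) - ∑ j, (x' j - y j) ^ 2) / (2 * t)) with hRdef
  have hsqm : ∀ z : Fin d → ℝ, Measurable fun y : Fin d → ℝ ↦ ∑ j, (z j - y j) ^ 2 := fun z ↦
    (continuous_finsetSum _ fun j _ ↦ (continuous_const.sub (continuous_apply j)).pow 2).measurable
  have hRm : Measurable R := (Real.measurable_exp.comp (((hsqm x).sub (hsqm x')).div_const _))
  -- the kernels have mass one
  have hone : ∀ z : Fin d → ℝ, (∫ y : Fin d → ℝ, (2 * Real.pi * t) ^ (-(d : ℝ) / 2) *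
      Real.exp (-(∑ j, (z j - y j) ^ 2) / (2 * t))) = 1 := by
    intro z
    have h1 := hW.integral_comp_shift_eq ht (f := fun _ ↦ (1 : ℝ)) measurable_const z
    simp only [mul_one, integral_const, probReal_univ, one_smul] at h1
    exact h1.symm
  -- the four expectations
  have hE1 : ∫ ω, h (x + W t ω) ∂P = h x := hW.integral_comp_add_eq_of_harmonic hh hΔ hC x t
  have hE2 : ∫ ω, R (x + W t ω) * h (x + W t ω) ∂P = h x' := by
    rw [hW.integral_comp_shift_eq ht (f := fun y ↦ R y * h y) (hRm.mul hhm) x]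
    have hpt : ∀ y, K x y * (R y * h y) = K x' y * h y := fun y ↦ by
      rw [← mul_assoc, hKdef, hRdef, kernel_mul_ratio]
    simp only [hKdef] at hpt
    simp_rw [hpt]
    rw [← hW.integral_comp_shift_eq ht hhm x']
    exact hW.integral_comp_add_eq_of_harmonic hh hΔ hC x' t
  have hE3 : ∫ ω, R (x + W t ω) ∂P = 1 := by
    rw [hW.integral_comp_shift_eq ht hRm x]
    have hpt : ∀ y, K x y * R y = K x' y := fun y ↦ by
      rw [hKdef, hRdef, kernel_mul_ratio]
    simp only [hKdef] at hpt
    simp_rw [hpt]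
    exact hone x'
  have hE4 : ∫ ω, R (x + W t ω) ^ 2 ∂P = Real.exp ((∑ j, (x j - x' j) ^ 2) / t) := by
    rw [hW.integral_comp_shift_eq ht (f := fun y ↦ R y ^ 2) (hRm.pow_const 2) x]
    have hpt : ∀ y, K x y * R y ^ 2 = Real.exp ((∑ j, (x j - x' j) ^ 2) / t) *
        K (fun i ↦ 2 * x' i - x i) y := fun y ↦ by
      rw [hKdef, hRdef, kernel_mul_ratio_sq ht']
    simp only [hKdef] at hpt
    simp_rw [hpt]
    rw [integral_const_mul, hone, mul_one]
  -- integrability (the integrals above are nonzero)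
  have hRXm : AEStronglyMeasurable (fun ω ↦ R (x + W t ω)) P :=
    (hRm.comp (measurable_const.add (hW.measurable t))).aestronglyMeasurable
  have hIR : Integrable (fun ω ↦ R (x + W t ω)) P := by
    by_contra hni
    rw [integral_undef hni] at hE3
    exact zero_ne_one hE3
  have hIR2 : Integrable (fun ω ↦ R (x + W t ω) ^ 2) P := by
    by_contra hni
    rw [integral_undef hni] at hE4
    exact (Real.exp_pos _).ne hE4
  have hIh : Integrable (fun ω ↦ h (x + W t ω)) P :=
    integrable_of_abs_le (hhm.comp (measurable_const.add (hW.measurable t))) fun ω ↦ hC _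
  have hIRh : Integrable (fun ω ↦ R (x + W t ω) * h (x + W t ω)) P := by
    refine (hIR.norm.mul_const C).mono' (hRXm.mul hIh.aestronglyMeasurable) ?_
    refine ae_of_all _ fun ω ↦ ?_
    rw [norm_mul, Real.norm_eq_abs, Real.norm_eq_abs]
    exact mul_le_mul_of_nonneg_left (hC _) (abs_nonneg _)
  -- `h(x) − h(x') = E[h(X)(1 − R(X))]`
  have hdiff : h x - h x' = ∫ ω, h (x + W t ω) * (1 - R (x + W t ω)) ∂P := by
    have hfun : (fun ω ↦ h (x + W t ω) * (1 - R (x + W t ω))) =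
        fun ω ↦ h (x + W t ω) - R (x + W t ω) * h (x + W t ω) := by
      funext ω
      ring
    rw [hfun, integral_sub hIh hIRh, hE1, hE2]
  -- `E(1 − R(X))² = e^{|x−x'|²/t} − 1`
  have hY2 : Integrable (fun ω ↦ (1 - R (x + W t ω)) ^ 2) P := by
    have hfun : (fun ω ↦ (1 - R (x + W t ω)) ^ 2) =
        fun ω ↦ 1 - 2 * R (x + W t ω) + R (x + W t ω) ^ 2 := by
      funext ω
      ring
    rw [hfun]
    exact ((integrable_const _).sub (hIR.const_mul _)).add hIR2
  have hEY2 : ∫ ω, (1 - R (x + W t ω)) ^ 2 ∂P = Real.exp ((∑ j, (x j - x' j) ^ 2) / t) - 1 := by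
    have hfun : (fun ω ↦ (1 - R (x + W t ω)) ^ 2) =
        fun ω ↦ 1 - 2 * R (x + W t ω) + R (x + W t ω) ^ 2 := by
      funext ω
      ring
    rw [hfun, integral_add (f := fun ω ↦ 1 - 2 * R (x + W t ω)) (g := fun ω ↦ R (x + W t ω) ^ 2)
      ((integrable_const _).sub (hIR.const_mul _)) hIR2,
      integral_sub (integrable_const _) (hIR.const_mul _), integral_const_mul, integral_const,
      probReal_univ, one_smul, hE3, hE4]
    ring
  -- Cauchy–Schwarz
  have hCS : ∫ ω, |1 - R (x + W t ω)| ∂P ≤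
      Real.sqrt (Real.exp ((∑ j, (x j - x' j) ^ 2) / t) - 1) := by
    have h1 := sq_integral_abs_le_integral_sq (P := P) (Y := fun ω ↦ 1 - R (x + W t ω))
      (aestronglyMeasurable_const.sub hRXm) hY2
    rw [hEY2] at h1
    have hE0 : 0 ≤ Real.exp ((∑ j, (x j - x' j) ^ 2) / t) - 1 := by
      have h2 := Real.add_one_le_exp ((∑ j, (x j - x' j) ^ 2) / t)
      have h3 : 0 ≤ (∑ j, (x j - x' j) ^ 2) / (t : ℝ) := by positivity
      linarith
    exact (Real.le_sqrt (integral_nonneg fun ω ↦ abs_nonneg _) hE0).2 h1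
  rw [hdiff]
  calc |∫ ω, h (x + W t ω) * (1 - R (x + W t ω)) ∂P|
      ≤ ∫ ω, |h (x + W t ω) * (1 - R (x + W t ω))| ∂P := by
        rw [← Real.norm_eq_abs]
        exact (norm_integral_le_integral_norm _).trans_eq (by simp only [Real.norm_eq_abs])
    _ ≤ ∫ ω, C * |1 - R (x + W t ω)| ∂P := by
        refine integral_mono_of_nonneg (ae_of_all _ fun ω ↦ abs_nonneg _)
          ((((integrable_const (1 : ℝ)).sub hIR).abs).const_mul C) (ae_of_all _ fun ω ↦ ?_)
        dsimp only
        rw [abs_mul]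
        exact mul_le_mul_of_nonneg_right (hC _) (abs_nonneg _)
    _ = C * ∫ ω, |1 - R (x + W t ω)| ∂P := integral_const_mul _ _
    _ ≤ C * Real.sqrt (Real.exp ((∑ j, (x j - x' j) ^ 2) / t) - 1) :=
        mul_le_mul_of_nonneg_left hCS hC0

/-! ### §3 Liouville's theorem -/

/-- **Durrett, Exercise 9.5.1 (Liouville's theorem, by Brownian motion): "Suppose `h` is bounded
and harmonic on `R^d`. Prove that `h` is constant."** For `h : ℝᵈ → ℝ` of class `C²`, bounded,
with `Δh = 0` everywhere, `h(x) = h(x')` for all `x, x'`: by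
`abs_sub_le_mul_sqrt_exp_sub_one`, `|h(x) − h(x')| ≤ ‖h‖_∞ √(e^{|x−x'|²/t} − 1) → 0` as `t → ∞`.
(`W` is any `d`-dimensional Brownian motion in the sense of the tree's `IsBrownianVec`.)
[cite: Durrett2019, §9.5 Exercise 9.5.1] -/
theorem Durrett2019_exercise_9_5_1 [IsProbabilityMeasure P] (hW : IsBrownianVec W P)
    {h : (Fin d → ℝ) → ℝ} (hh : ContDiff ℝ 2 h) (hΔ : ∀ y, lap h y = 0) {C : ℝ}
    (hC : ∀ y, |h y| ≤ C) (x x' : Fin d → ℝ) : h x = h x' := by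
  set a : ℝ := ∑ j, (x j - x' j) ^ 2 with hadef
  -- the bound along `t = n + 1 → ∞`
  have hb : ∀ n : ℕ, |h x - h x'| ≤ C * Real.sqrt (Real.exp (a * (1 / ((n : ℝ) + 1))) - 1) := by
    intro n
    have h1 := hW.abs_sub_le_mul_sqrt_exp_sub_one hh hΔ hC x x' (t := (n : ℝ≥0) + 1)
      (by positivity)
    have h2 : (((n : ℝ≥0) + 1 : ℝ≥0) : ℝ) = (n : ℝ) + 1 := by push_cast; ring
    rw [h2, ← hadef] at h1
    rwa [mul_one_div]
  have hlim : Tendsto (fun n : ℕ ↦ C * Real.sqrt (Real.exp (a * (1 / ((n : ℝ) + 1))) - 1)) atTop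
      (𝓝 0) := by
    have h1 : Tendsto (fun n : ℕ ↦ a * (1 / ((n : ℝ) + 1))) atTop (𝓝 (a * 0)) :=
      tendsto_const_nhds.mul tendsto_one_div_add_atTop_nhds_zero_nat
    rw [mul_zero] at h1
    have h2 : Tendsto (fun n : ℕ ↦ Real.exp (a * (1 / ((n : ℝ) + 1))) - 1) atTop
        (𝓝 (Real.exp 0 - 1)) := (Real.continuous_exp.tendsto _ |>.comp h1).sub tendsto_const_nhds
    rw [Real.exp_zero, sub_self] at h2
    have h3 := (Real.continuous_sqrt.tendsto _).comp h2
    rw [Real.sqrt_zero] at h3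
    simpa using h3.const_mul C
  have h0 : |h x - h x'| ≤ 0 := ge_of_tendsto' hlim hb
  exact eq_of_abs_sub_nonpos h0

end IsBrownianVec

end Literature.Probability.Process
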